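import Summits.QuantumFields.YangMills.Theorems.AllWindowsColdBoxBoxHighLineEdgeChartMoments
import Summits.QuantumFields.YangMills.Theorems.AllWindowsColdBoxBoxHighLineGaussianSmallFieldTail
import Summits.QuantumFields.YangMills.Theorems.AllWindowsColdBoxBoxHighLineErrorBudget

/-!
# ASSEMBLY-S5 §6 step 6 — the small-field MASS hypotheses `hD` DISCHARGED in the §1 letters
# (LEAD ym-line-sfw-p2 g77 `g77-ASSEMBLY-E2-memo.md` step 6; LINE-19 S5 ⟨stmt-QuantumFields-24004⟩/⟨24335⟩)

Width seat `ym-line-sfw-p2-w3` (g40).  Small bookkeeping bricks so that the final T-S5.13 file cites names only: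

* `GaussTail.gaussAvg_sfInd_eq` (`E₀[1_D] = 1 − E₀[1 − 1_D]`), `GaussTail.half_le_gaussAvg_sfInd`;
* ★ `GaussTail.exists_beta0_half_le_gaussAvg_sfInd` — in the §1 letters (`s = β^{κ₃−1/2}`, `H ≤ β^θ + 1`, `κ₃ > 0`): `∃ β₀, ∀ β ≥ β₀`, BOTH
  `1/2 ≤ gaussAvg β H (sfInd H s)` (the `hD` of ✓`GaussNormalForm.tiltExp_muD_zero_le_two_mul`, 13K-K4, `TiltUSlots`) AND `0 < ∫ sfInd·gaussWeight`
  (the `hD` of ✓13u / ✓`abs_tiltCum3_muD_zero_chartPlaqCost_le`)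
  (✓6g `gaussianSmallFieldTail` + ✓`ErrorBudget.exists_forall_natPow_exp_le`).

Everything proved, no definitions, standard axioms.  HONEST LABEL: bookkeeping for the OPEN assembly T-S5.13 of the XL stub S5 of a critic-PASSed DRAFT
line; S5, U5, ⟨24004⟩ ⟨24335⟩ ⟨24336⟩ remain OPEN; no crux, rung or summit is proved; **the Yang–Mills mass gap is NOT proved by this file.**
-/

set_option autoImplicit false

noncomputable section

open MeasureTheory Set

namespace Summit.QuantumFields.YangMills.Theorems.AllWindowsColdBoxBoxHighLine

namespace GaussTail

variable {H : ℕ}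

/-- `1_D · w = 1_D-indicator of w`. -/
theorem sfInd_mul_gaussWeight (β s : ℝ) (a : LandauFree H → E3) :
    sfInd H s a * gaussWeight β H a = (smallField H s).indicator (gaussWeight β H) a := by
  by_cases ha : a ∈ smallField H s
  · rw [sfInd, Set.indicator_of_mem ha, Set.indicator_of_mem ha, one_mul]
  · rw [sfInd, Set.indicator_of_notMem ha, Set.indicator_of_notMem ha, zero_mul]

/-- `1_D · w` is integrable (`β > 0`). -/
theorem integrable_sfInd_mul_gaussWeight {β : ℝ} (hβ : 0 < β) (s : ℝ) :
    Integrable fun a : LandauFree H → E3 => sfInd H s a * gaussWeight β H a := by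
  have h : (fun a : LandauFree H → E3 => sfInd H s a * gaussWeight β H a) = (smallField H s).indicator (gaussWeight β H) :=
    funext (sfInd_mul_gaussWeight β s)
  rw [h]
  exact (EdgeChartGaussian.integrable_gaussWeight H hβ).indicator (ChartGauss.measurableSet_smallField s)

/-- **`E₀[1_D] = 1 − E₀[1 − 1_D]`.** -/
theorem gaussAvg_sfInd_eq {β : ℝ} (hβ : 0 < β) (s : ℝ) :
    gaussAvg β H (sfInd H s) = 1 - gaussAvg β H (fun a => 1 - sfInd H s a) := by
  have hZ := EdgeChartGaussian.integral_gaussWeight_pos H hβ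
  have hsub : (∫ a : LandauFree H → E3, (1 - sfInd H s a) * gaussWeight β H a) =
      (∫ a : LandauFree H → E3, gaussWeight β H a) - ∫ a : LandauFree H → E3, sfInd H s a * gaussWeight β H a := by
    rw [← integral_sub (EdgeChartGaussian.integrable_gaussWeight H hβ) (integrable_sfInd_mul_gaussWeight hβ s)]
    exact integral_congr_ae (Filter.Eventually.of_forall fun a => by ring)
  unfold gaussAvg
  rw [hsub, sub_div, div_self hZ.ne']
  ring

/-- **`E₀[1 − 1_D] ≤ 1/2 ⇒ 1/2 ≤ E₀[1_D]`.** -/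
theorem half_le_gaussAvg_sfInd {β : ℝ} (hβ : 0 < β) {s : ℝ} (h : gaussAvg β H (fun a => 1 - sfInd H s a) ≤ 1 / 2) :
    1 / 2 ≤ gaussAvg β H (sfInd H s) := by
  rw [gaussAvg_sfInd_eq hβ]; linarith

/-- **`0 < E₀[1_D] ⇒ 0 < ∫ 1_D · w`** (the `hD` hypothesis of the `μ_D` tilt lemmas). -/
theorem integral_sfInd_mul_gaussWeight_pos_of_gaussAvg_pos {β : ℝ} (hβ : 0 < β) {s : ℝ} (h : 0 < gaussAvg β H (sfInd H s)) :
    0 < ∫ a : LandauFree H → E3, sfInd H s a * gaussWeight β H a := by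
  have hZ := EdgeChartGaussian.integral_gaussWeight_pos H hβ
  unfold gaussAvg at h
  rcases div_pos_iff.1 h with ⟨h1, _⟩ | ⟨_, h2⟩
  · exact h1
  · exact absurd h2 (not_lt.2 hZ.le)

/-- ★ **The small-field mass in the §1 letters**: for `θ ≥ 0`, `κ₃ > 0` there is `β₀ ≥ 1` such that for all `β ≥ β₀`, `1 ≤ H ≤ β^θ + 1` and
`s = β^{κ₃ − 1/2}`: `1/2 ≤ gaussAvg β H (sfInd H s)` and `0 < ∫ sfInd·gaussWeight` (✓6g: `E₀[1 − 1_D] ≤ C·H⁴·e^{−cβs²} = C·H⁴·e^{−cβ^{2κ₃}} → 0`). -/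
theorem exists_beta0_half_le_gaussAvg_sfInd {θ κ₃ : ℝ} (hθ : 0 ≤ θ) (hκ₃ : 0 < κ₃) :
    ∃ β₀ : ℝ, 1 ≤ β₀ ∧ ∀ β : ℝ, β₀ ≤ β → ∀ H : ℕ, 1 ≤ H → (H : ℝ) ≤ β ^ θ + 1 →
      1 / 2 ≤ gaussAvg β H (sfInd H (β ^ (κ₃ - 1 / 2))) ∧
        0 < ∫ a : LandauFree H → E3, sfInd H (β ^ (κ₃ - 1 / 2)) a * gaussWeight β H a := by
  obtain ⟨C, c, hc, h6g⟩ := gaussianSmallFieldTail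
  obtain ⟨β₀, hβ₀, hB⟩ := ErrorBudget.exists_forall_natPow_exp_le hθ (γ := 2 * κ₃) (by positivity) hc (ε := 1 / 2) (by norm_num) C 0 4
  refine ⟨β₀, hβ₀, fun β hβ H hH hHβ => ?_⟩
  have hβ1 : 1 ≤ β := hβ₀.trans hβ
  have hβpos : 0 < β := by linarith
  set s : ℝ := β ^ (κ₃ - 1 / 2) with hs
  have hspos : 0 < s := Real.rpow_pos_of_pos hβpos _
  have hβs : c * β * s ^ 2 = c * β ^ (2 * κ₃) := by
    have h : β * s ^ 2 = β ^ (2 * κ₃) := by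
      calc β * s ^ 2 = β ^ (1 : ℝ) * β ^ ((κ₃ - 1 / 2) + (κ₃ - 1 / 2)) := by rw [Real.rpow_one, hs, sq, Real.rpow_add hβpos]
        _ = β ^ (1 + ((κ₃ - 1 / 2) + (κ₃ - 1 / 2))) := (Real.rpow_add hβpos _ _).symm
        _ = β ^ (2 * κ₃) := by congr 1; ring
    rw [mul_assoc, h]
  have h1 := h6g H hH β s hβpos hspos
  rw [hβs] at h1
  have h2 := hB β hβ H hH hHβ
  rw [Real.rpow_zero, mul_one] at h2
  have hhalf : 1 / 2 ≤ gaussAvg β H (sfInd H s) := half_le_gaussAvg_sfInd hβpos (h1.trans h2)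
  exact ⟨hhalf, integral_sfInd_mul_gaussWeight_pos_of_gaussAvg_pos hβpos (by linarith)⟩

end GaussTail


end Summit.QuantumFields.YangMills.Theorems.AllWindowsColdBoxBoxHighLine

end
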